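import Summits.BirchSwinnertonDyer.BirchSwinnertonDyer.Theorems.CMKolyvaginAtInertTwoAdaptiveDataTelescope
import Summits.BirchSwinnertonDyer.BirchSwinnertonDyer.Theorems.CMKolyvaginAtInertTwoCebotarevBinderPair
import Summits.BirchSwinnertonDyer.BirchSwinnertonDyer.Theorems.CMKolyvaginAtInertTwoRegularTorsionAtTwo
import HarnessLib

/-!
# Route `CMKolyvaginAtInertTwo`, crux `CMKolyvaginExactAtInertTwo` (stmt-BirchSwinnertonDyer-24277):
# THE ADAPTIVE TELESCOPE AT `p = 2` ON THE PAIR CURRENCY — McCallum Thm. 5.4 "≤" with the Čebotarev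
# binder DISCHARGED (`#Zp · #Zm ≤ 2^{M₀}` modulo the Cassels–Tate value formula and the lift groups)

Seat `bsd-line-cmk2-p1` g13 (cell `bsd-print-cf2`); helper (`--supports stmt-BirchSwinnertonDyer-24277`).
THEOREMS ONLY: no definition, no named fact, no `sorry`; no item is closed; BSD is not proved by this.

Assembly of this seat's files: the abstract telescope `KolyvaginAdaptiveData.card_mul_card_le_of_
casselsTate_adaptive` (p673519) applied to split data on the eigen-pair carrier
`V = H¹(K,E[2^M])^{ε} × H¹(K,E[2^M])^{−ε}` whose eigengroups / strict conditions / Kolyvagin primes are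
the standard ones (`pairEig`, `pairA`, Gross-form primes of `(2, M)` in a support `S`) — e.g. the
instance `pairData` of p675421 — with
* `Δ := pairDelta` and `hΔpure := eq_zero_of_mem_pairDelta_of_mem_pairEig` (p675421),
* `hCeb₂ :=` the order-form Čebotarev binder `cebotarev_binder_pair` (p677581), fed with the regular
  element of `E[2^M]` of `exists_regular_torsion_of_Δ_neg` (p677882, `Δ_E < 0`),
so that the ONLY remaining hypotheses are McCallum's Cassels–Tate value formula `hCTV` (Prop. 4.7 +
Lemma 5.3 + Prop. 4.4 in order language, for the given data) and the two finite isotropic lift groups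
`Zp, Zm` with `ℤx ⊓ (Zp ⊔ Zm) = ⊥`, (IND) `(Zp ⊔ Δ) ⊓ Zm = ⊥` and room — plus the Čebotarev-side
habitat inputs (`ρ̄_{E,2}` onto, `Δ_E < 0`, `Δ_E ∉ K²`, the Cartan element `z` with `hcomm`, the
support hypothesis `hS`) and the Čebotarev density theorem as the hypothesis `hC` (the tree's
`Literature.NumberTheory.Automorphic.chebotarev_artinRep_holds` discharges it).

* `card_mul_card_le_two_pow_of_pair` — for any `Sd : SplitDataM (PairV W c M ε) (Places K)` with
  `Sd.p = 2`, `Sd.eig = pairEig`, `Sd.A = pairA`, `Sd.Kol = (Gross-form ∧ S)`; for the instance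
  `pairData W c M hdiv hK D x₀ M₀ hP hxε hx` (p675421) these four side conditions are
  `rfl, rfl, rfl, fun _ ↦ Iff.rfl` (`pairData_p`, `pairData_eig`, `pairData_A`, `pairData_kol_iff`).

References: [McCallumLMS1991] §1 Theorem, §3 Prop. 3.1 / Cor. 3.2, §5 Thm. 5.4, Cor. 5.6;
[GrossLMS1991] §9; [Kolyvagin1989Izv] §3.
-/

-- single-conjunct summit: `Summit.BirchSwinnertonDyer.BirchSwinnertonDyer.…` repeats the name by design
set_option linter.dupNamespace false
set_option autoImplicit false

noncomputable section

open scoped Classical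
open WeierstrassCurve NumberField IsDedekindDomain Field
open Literature.NumberTheory.GaloisRepresentations
open Literature.NumberTheory.EllipticCurves Literature.NumberTheory.EllipticCurves.KolyvaginDescent

namespace Summit.BirchSwinnertonDyer.BirchSwinnertonDyer.Theorems.KolyvaginPairDataTwo

open KolyvaginAdaptiveData

/-- **McCallum Thm. 5.4 "≤" at `p = 2` on the pair currency, Čebotarev discharged.** For split descent
data `Sd` on `V = H¹(K,E[2^M])^{ε} × H¹(K,E[2^M])^{−ε}` with the standard eigengroups, strict
conditions and Kolyvagin primes (`Sd.eig = pairEig`, `Sd.A = pairA`, `Sd.Kol ℓ ↔` Gross-form of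
`(2, M)` with `S ℓ`, `Sd.p = 2`; e.g. `Sd = pairData …`, all by `rfl`), on the habitat (`ρ̄_{E,2}` onto, `Δ_E < 0`, `Δ_E ∉ K²`,
Cartan element `z` with `hcomm`, support `S ⊇` Gross-form primes): GIVEN McCallum's Cassels–Tate value
formula `hCTV` for `Sd` and finite isotropic lift groups `Zp ≤ Sel ∩ V^{ε}`, `Zm ≤ Sel ∩ V^{−ε}` with
`ℤx ⊓ (Zp ⊔ Zm) = ⊥`, (IND) `(Zp ⊔ Δ) ⊓ Zm = ⊥` (`Δ = pairDelta`) and room `expo + M₀ ≤ M`, one has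
**`#Zp · #Zm ≤ 2^{M₀}`**. [cite: McCallumLMS1991, §1 Theorem; §5 Thm. 5.4, Cor. 5.6; §3 Prop. 3.1, Cor. 3.2]
[cite: GrossLMS1991, §9] -/
theorem card_mul_card_le_two_pow_of_pair (hC : Literature.NumberTheory.Automorphic.chebotarev_artinRep)
    {N : ℕ} [NeZero N] (W : WeierstrassCurve ℚ) [W.IsElliptic] {K : Type} [Field K] [NumberField K]
    (hK : IsImaginaryQuadratic K) (hρ : W.HasSurjectiveModNGaloisRep 2) (hΔ : W.Δ < 0)
    (hΔK : ¬ IsSquare (W.baseChange K).Δ) {c : K ≃ₐ[ℚ] K} (hc : c ≠ 1)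
    {c₀ : absoluteGaloisGroup ℚ} (hc₀ : IsComplexConjugation (Rat.castHom ℝ) c₀)
    {M : ℕ} (hM : 1 ≤ M) {z : absoluteGaloisGroup K}
    (hzfix : ∀ P : geomTorsion (W.baseChange K) ((2 : ℕ) : ℤ), z • P = P → P = 0)
    (hcomm : ∀ π ∈ torsionFixing (W.baseChange K) ((2 : ℕ) : ℤ),
      ∀ P : geomTorsion (W.baseChange K) ((2 ^ M : ℕ) : ℤ), π • z • P = z • π • P)
    {S : ℕ → Prop} (hS : ∀ ℓ, IsKolyvaginPrime N W K 2 ℓ → FrobEqFrobInfty W K (2 ^ M) ℓ → S ℓ)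
    {ε : ℤ} (hε : ε = 1 ∨ ε = -1) (Sd : SplitDataM (PairV W c M ε) (Places K))
    (hp : Sd.p = 2) (hEig : Sd.eig = pairEig W c M ε)
    (hA : Sd.A = pairA (N := N) W c M ε)
    (hKol : ∀ ℓ, Sd.Kol ℓ ↔ IsKolyvaginPrime N W K 2 ℓ ∧ FrobEqFrobInfty W K (2 ^ M) ℓ ∧ S ℓ)
    {R : Type*} [AddCommGroup R] (P : Sd.Sel →+ Sd.Sel →+ R)
    (hCTV : ∀ ℓ m : ℕ, Sd.Kol ℓ → KolSupp Sd.Kol (ℓ * m) → ¬ ℓ ∣ m →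
      ∀ (j N' a b : ℕ) (t : PairV W c M ε) (ht : t ∈ Sd.Sel)
        (hz : ((Sd.p : ℤ) ^ j) • Sd.c (ℓ * m) ∈ Sd.Sel),
      ((Sd.p : ℤ) ^ N') • t = 0 → t ∈ Sd.eig (Sd.ε * (-1) ^ (ℓ * m).primeFactors.card) →
      (∀ q ∈ m.primeFactors, t ∈ Sd.A q) → Sd.M - Sd.M₀ ≤ j → N' + Sd.M₀ ≤ Sd.M → N' ≤ j →
      a + b + 1 = N' →
      ((Sd.p : ℤ) ^ (a + (j - N'))) • Sd.c m ∉ Sd.A ℓ → ((Sd.p : ℤ) ^ b) • t ∉ Sd.A ℓ →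
      P ⟨_, hz⟩ ⟨t, ht⟩ ≠ 0)
    (Zp Zm : AddSubgroup (PairV W c M ε)) [Finite Zp] [Finite Zm]
    (hZp : ∀ v ∈ Zp, v ∈ Sd.Sel ∧ v ∈ Sd.eig Sd.ε) (hZm : ∀ v ∈ Zm, v ∈ Sd.Sel ∧ v ∈ Sd.eig (-Sd.ε))
    (hiso : ∀ u, ∀ hu : u ∈ Zp ⊔ Zm, ∀ v, ∀ hv : v ∈ Zp ⊔ Zm, ∀ (hu' : u ∈ Sd.Sel) (hv' : v ∈ Sd.Sel),
      P ⟨u, hu'⟩ ⟨v, hv'⟩ = 0)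
    (hind : AddSubgroup.zmultiples Sd.x ⊓ (Zp ⊔ Zm) = ⊥)
    (hIND : (Zp ⊔ pairDelta W c M ε) ⊓ Zm = ⊥)
    (hroom : ∀ v ∈ Zp ⊔ Zm, Sd.expo v + Sd.M₀ ≤ Sd.M) :
    Nat.card Zp * Nat.card Zm ≤ 2 ^ Sd.M₀ := by
  obtain ⟨m₀, hm⟩ := exists_regular_torsion_of_Δ_neg W hK hΔ hc hc₀ hM
  have h := card_mul_card_le_of_casselsTate_adaptive Sd P hCTV (pairDelta W c M ε)
    (fun d hd e _ hde ↦ eq_zero_of_mem_pairDelta_of_mem_pairEig W c M hε d hd e (by rw [← hEig]; exact hde))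
    (fun T g₁ g₂ ν I hν hg₁ hg₂ hT H1 H2 b ↦ by
      -- translate the binder to the pair currency and apply `cebotarev_binder_pair`
      rw [hEig] at hg₁ hg₂
      have hT' : ∀ t ∈ T, ∃ e : ℤ, (e = 1 ∨ e = -1) ∧ t ∈ pairEig W c M ε e := by
        intro t ht
        obtain ⟨e, he, hte⟩ := hT t ht
        exact ⟨e, he, by rw [← hEig]; exact hte⟩
      have he₁ : addOrderOf g₁ = 2 ^ Sd.expo g₁ := by
        have h := Sd.addOrderOf_eq_pow_expo g₁
        rwa [hp] at h
      rw [hp] at H1 H2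
      have H2' : 1 ≤ I → ∀ d ∈ pairDelta W c M ε,
          ∀ u ∈ AddSubgroup.closure (T : Set (PairV W c M ε)), u ∈ pairEig W c M ε (-ν) →
          ∀ v ∈ AddSubgroup.closure (T : Set (PairV W c M ε)), v ∈ pairEig W c M ε ν →
          ((2 : ℕ) : ℤ) • v = 0 → (((2 : ℕ) : ℤ) ^ (I - 1)) • g₂ ≠ d + u + v := by
        intro hI d hd u hu huν v hv hvν h2v
        exact H2 hI d hd u hu (by rw [hEig]; exact huν) v hv (by rw [hEig]; exact hvν) h2v
      obtain ⟨ℓ, hbℓ, hkol, hpool, hfull, hge⟩ :=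
        cebotarev_binder_pair hC W hK hρ hΔK hc hc₀ hM hzfix hcomm hS m₀ hm hε T g₁ g₂ ν I
          (Sd.expo g₁) hν hg₁ hg₂ hT' he₁ H1 H2' b
      refine ⟨ℓ, hbℓ, (hKol ℓ).mpr hkol, ?_, ?_, ?_⟩
      · intro t ht
        rw [hA]
        exact hpool t ht
      · intro j hj
        rw [hp, hA]
        exact hfull j hj
      · intro i hi
        rw [hp, hA]
        exact hge i hi)
    Zp Zm hZp hZm hiso hind hIND hroom
  rwa [hp] at h


end Summit.BirchSwinnertonDyer.BirchSwinnertonDyer.Theorems.KolyvaginPairDataTwo
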